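import Mathlib.Analysis.Normed.Group.AddCircle
import Mathlib.Analysis.Fourier.AddCircleMulti
import HarnessLib

/-!
# The nearest-image pair distance on the torus `(ℝ/ℤ)^{N×3}`

Analysis/FunctionSpaces support file (one definition and its elementary API, everything proved;
global `volume` convention of `FlatTorus`). For `N` particles on the unit torus, configurations
`t : (Fin N × Fin 3) → ℝ/ℤ` (`UnitAddTorus (Fin N × Fin 3)`), and particles `i`, `j`, the
**nearest-image pair distance** is

  `Torus.pairDist i j t = (∑ₖ ‖t(i,k) - t(j,k)‖²)^{1/2}`,

`‖·‖` the quotient norm of `ℝ/ℤ` (`UnitAddCircle.norm_eq`: `‖↑x‖ = |x - round x|`), i.e. the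
Euclidean distance from any lift of `xᵢ - xⱼ` to the lattice `ℤ³` — the distance through which a
radial pair potential is felt in a periodic box of side `1` with the nearest-image convention
(Lieb–Seiringer–Solovej–Yngvason 2005, Ch. 2). The hard-core tube of radius `r` of the pair is
`{pairDist i j < r}` (open), and this file supplies what the tube Hardy inequality
(`TorusPairTubeHardy`) and the cut-off near the hard core need:

* `pairDist_nonneg`, `pairDist_sq`, `continuous_pairDist`, `pairDist_comm`;
* `exists_third_le_norm_sq` — some coordinate carries a third of `pairDist²`;
* `pair_coord_add_single` — moving the coordinate `(i, k)` by `s` moves the `k`-th pair coordinate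
  by `s` and no other (`i ≠ j`); `pairDist_add_single_of_ne` — pairs not containing the moved
  particle are unchanged; `abs_pairDist_add_single_sub_le` — **`pairDist i j` is `1`-Lipschitz along
  every coordinate line of particle `i`** (`|pairDist(t + s𝐞_{(i,k)}) - pairDist(t)| ≤ |s|`);
* lifts: `UnitAddCircle.norm_coe_le_abs` (`‖↑x‖ ≤ |x|`), `UnitAddCircle.exists_lift_abs_eq_norm`.

## Mathlib / tree search

Mathlib: `UnitAddCircle.norm_eq`, `abs_sub_round`, `round_eq_zero_iff`, `AddCircle.coe_eq_zero_iff`;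
no pair distances / nearest-image conventions. Tree: `Literature/MathematicalPhysics/QuantumManyBody/`
(`periodicInteraction`, cell picture on `ℝ^{3N}`; the torus-side dictionary is not made here).

## References

* E. H. Lieb, R. Seiringer, J. P. Solovej, J. Yngvason, *The Mathematics of the Bose Gas and its
  Condensation*, Birkhäuser (2005), Ch. 2.
-/

noncomputable section

open Set Function UnitAddTorus

namespace Literature.Analysis.FunctionSpaces

/-! ## A square-root inequality -/

/-- `√(c + b²) ≤ √(c + a²) + |b - a|` for `c, a ≥ 0`: the Euclidean norm is `1`-Lipschitz in one
coordinate, the others (`c`) being fixed. [folklore] -/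
theorem sqrt_add_sq_le_sqrt_add_sq_add_abs {c a : ℝ} (hc : 0 ≤ c) (ha : 0 ≤ a) (b : ℝ) :
    Real.sqrt (c + b ^ 2) ≤ Real.sqrt (c + a ^ 2) + |b - a| := by
  have hca : 0 ≤ c + a ^ 2 := by positivity
  have hs : 0 ≤ Real.sqrt (c + a ^ 2) := Real.sqrt_nonneg _
  have hsq : Real.sqrt (c + a ^ 2) ^ 2 = c + a ^ 2 := Real.sq_sqrt hca
  have hale : a ≤ Real.sqrt (c + a ^ 2) := by
    rw [Real.le_sqrt ha hca]
    linarith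
  rw [Real.sqrt_le_iff]
  refine ⟨by positivity, ?_⟩
  nlinarith [abs_nonneg (b - a), le_abs_self (b - a), mul_nonneg ha (abs_nonneg (b - a)),
    mul_le_mul_of_nonneg_right hale (abs_nonneg (b - a)), sq_abs (b - a)]

/-- `|√(c + b²) - √(c + a²)| ≤ |b - a|` for `c, a, b ≥ 0`. [folklore] -/
theorem abs_sqrt_add_sq_sub_sqrt_add_sq_le {c a b : ℝ} (hc : 0 ≤ c) (ha : 0 ≤ a) (hb : 0 ≤ b) :
    |Real.sqrt (c + b ^ 2) - Real.sqrt (c + a ^ 2)| ≤ |b - a| := by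
  rw [abs_sub_le_iff]
  constructor
  · linarith [sqrt_add_sq_le_sqrt_add_sq_add_abs hc ha b]
  · have := sqrt_add_sq_le_sqrt_add_sq_add_abs hc hb a
    rw [abs_sub_comm] at this
    linarith

/-! ## Lifts of points of `ℝ/ℤ` -/

/-- The quotient norm of `ℝ/ℤ` is at most the absolute value of any lift: `‖↑x‖ ≤ |x|`. [folklore] -/
theorem UnitAddCircle.norm_coe_le_abs (x : ℝ) : ‖((x : ℝ) : UnitAddCircle)‖ ≤ |x| := by
  rw [UnitAddCircle.norm_eq]
  by_cases hx : x ∈ Ico (-(1 / 2 : ℝ)) (1 / 2)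
  · rw [round_eq_zero_iff.2 hx, Int.cast_zero, sub_zero]
  · have h1 : (1 / 2 : ℝ) ≤ |x| := by
      rw [mem_Ico, not_and_or, not_le, not_lt] at hx
      rcases hx with h | h
      · rw [abs_of_neg (by linarith)]; linarith
      · rw [abs_of_nonneg (by linarith)]; linarith
    exact (abs_sub_round x).trans h1

/-- Every point of `ℝ/ℤ` has a lift of absolute value equal to its norm. [folklore] -/
theorem UnitAddCircle.exists_lift_abs_eq_norm (y : UnitAddCircle) :
    ∃ x : ℝ, ((x : ℝ) : UnitAddCircle) = y ∧ |x| = ‖y‖ := by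
  obtain ⟨x₀, rfl⟩ := QuotientAddGroup.mk_surjective y
  refine ⟨x₀ - round x₀, ?_, ?_⟩
  · rw [AddCircle.coe_sub, sub_eq_self, AddCircle.coe_eq_zero_iff]
    exact ⟨round x₀, by simp⟩
  · exact (UnitAddCircle.norm_eq (x := x₀)).symm

namespace Torus

variable {N : ℕ}

/-! ## The nearest-image pair distance -/

/-- **The nearest-image pair distance** of particles `i`, `j` of a configuration
`t : (Fin N × Fin 3) → ℝ/ℤ` on the unit torus: `(∑ₖ ‖t(i,k) - t(j,k)‖²)^{1/2}` with the quotient norm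
of `ℝ/ℤ` in each coordinate, i.e. the Euclidean distance from (a lift of) `xᵢ - xⱼ` to `ℤ³`
(LSSY 2005, Ch. 2: periodic box, interaction through the nearest image). [folklore] -/
def pairDist (i j : Fin N) (t : UnitAddTorus (Fin N × Fin 3)) : ℝ :=
  Real.sqrt (∑ k : Fin 3, ‖t (i, k) - t (j, k)‖ ^ 2)

/-- `pairDist` is nonnegative. [folklore] -/
theorem pairDist_nonneg (i j : Fin N) (t : UnitAddTorus (Fin N × Fin 3)) : 0 ≤ pairDist i j t :=
  Real.sqrt_nonneg _

/-- `pairDist² = ∑ₖ ‖t(i,k) - t(j,k)‖²`. [folklore] -/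
theorem pairDist_sq (i j : Fin N) (t : UnitAddTorus (Fin N × Fin 3)) :
    pairDist i j t ^ 2 = ∑ k : Fin 3, ‖t (i, k) - t (j, k)‖ ^ 2 :=
  Real.sq_sqrt (Finset.sum_nonneg fun _ _ => sq_nonneg _)

/-- `pairDist` is continuous. [folklore] -/
theorem continuous_pairDist (i j : Fin N) : Continuous (pairDist (N := N) i j) := by
  unfold pairDist
  fun_prop

/-- One squared coordinate norm is at least a third of `pairDist²` (the largest one). [folklore] -/
theorem exists_third_le_norm_sq (i j : Fin N) (t : UnitAddTorus (Fin N × Fin 3)) :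
    ∃ k : Fin 3, (∀ k', ‖t (i, k') - t (j, k')‖ ≤ ‖t (i, k) - t (j, k)‖) ∧
      pairDist i j t ^ 2 ≤ 3 * ‖t (i, k) - t (j, k)‖ ^ 2 := by
  obtain ⟨k, -, hk⟩ := Finset.exists_max_image Finset.univ (fun k : Fin 3 => ‖t (i, k) - t (j, k)‖)
    Finset.univ_nonempty
  refine ⟨k, fun k' => hk k' (Finset.mem_univ _), ?_⟩
  rw [pairDist_sq]
  calc ∑ k' : Fin 3, ‖t (i, k') - t (j, k')‖ ^ 2 ≤ ∑ _k' : Fin 3, ‖t (i, k) - t (j, k)‖ ^ 2 :=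
        Finset.sum_le_sum fun k' _ => pow_le_pow_left₀ (norm_nonneg _) (hk k' (Finset.mem_univ _)) 2
    _ = 3 * ‖t (i, k) - t (j, k)‖ ^ 2 := by simp [Finset.sum_const, Finset.card_univ]

/-- Moving the coordinate `(i, k)` by `s` changes the pair coordinates by `s` in the `k`-th slot
only (`i ≠ j`). [folklore] -/
theorem pair_coord_add_single {i j : Fin N} (hij : i ≠ j) (t : UnitAddTorus (Fin N × Fin 3)) (k k' : Fin 3)
    (s : UnitAddCircle) :
    (t + Pi.single (i, k) s : UnitAddTorus (Fin N × Fin 3)) (i, k') -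
        (t + Pi.single (i, k) s : UnitAddTorus (Fin N × Fin 3)) (j, k') =
      t (i, k') - t (j, k') + if k' = k then s else 0 := by
  simp only [Pi.add_apply]
  have hj : (Pi.single (i, k) s : UnitAddTorus (Fin N × Fin 3)) (j, k') = 0 :=
    Pi.single_eq_of_ne (fun h => hij (Prod.ext_iff.1 h).1.symm) _
  rw [hj, add_zero]
  by_cases hk : k' = k
  · subst hk
    rw [Pi.single_eq_same, if_pos rfl]
    abel
  · rw [Pi.single_eq_of_ne (fun h => hk (Prod.ext_iff.1 h).2) _, if_neg hk, add_zero, add_zero]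

/-- `pairDist` is symmetric in the two particles. [folklore] -/
theorem pairDist_comm (i j : Fin N) (t : UnitAddTorus (Fin N × Fin 3)) : pairDist i j t = pairDist j i t := by
  unfold pairDist
  congr 1
  exact Finset.sum_congr rfl fun k _ => by rw [← norm_neg, neg_sub]

/-- Pairs not containing the moved particle do not see the move. [folklore] -/
theorem pairDist_add_single_of_ne {i j l : Fin N} (hli : l ≠ i) (hlj : l ≠ j) (t : UnitAddTorus (Fin N × Fin 3))
    (k : Fin 3) (s : UnitAddCircle) :
    pairDist i j (t + Pi.single (l, k) s) = pairDist i j t := by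
  unfold pairDist
  congr 1
  refine Finset.sum_congr rfl fun k' _ => ?_
  simp only [Pi.add_apply]
  rw [Pi.single_eq_of_ne (fun h => hli (Prod.ext_iff.1 h).1.symm) _,
    Pi.single_eq_of_ne (fun h => hlj (Prod.ext_iff.1 h).1.symm) _, add_zero, add_zero]

/-- **`pairDist i j` is `1`-Lipschitz along the coordinate lines of particle `i`**:
`|pairDist(t + s𝐞_{(i,k)}) - pairDist(t)| ≤ |s|` (`i ≠ j`; one pair coordinate moves by `↑s`,
`‖↑s‖ ≤ |s|`, and the Euclidean norm is `1`-Lipschitz in each coordinate). [folklore] -/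
theorem abs_pairDist_add_single_sub_le {i j : Fin N} (hij : i ≠ j) (t : UnitAddTorus (Fin N × Fin 3))
    (k : Fin 3) (s : ℝ) :
    |pairDist i j (t + Pi.single (i, k) ((s : ℝ) : UnitAddCircle)) - pairDist i j t| ≤ |s| := by
  set t' : UnitAddTorus (Fin N × Fin 3) := t + Pi.single (i, k) ((s : ℝ) : UnitAddCircle) with ht'
  have hcoord : ∀ k', t' (i, k') - t' (j, k') =
      t (i, k') - t (j, k') + if k' = k then ((s : ℝ) : UnitAddCircle) else 0 :=
    fun k' => pair_coord_add_single hij t k k' _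
  -- the common part `c` of the two sums of squares
  set c : ℝ := ∑ k' ∈ Finset.univ.erase k, ‖t (i, k') - t (j, k')‖ ^ 2 with hc_def
  have hc0 : 0 ≤ c := Finset.sum_nonneg fun _ _ => sq_nonneg _
  have hsum : ∑ k' : Fin 3, ‖t (i, k') - t (j, k')‖ ^ 2 = c + ‖t (i, k) - t (j, k)‖ ^ 2 := by
    rw [← Finset.add_sum_erase _ _ (Finset.mem_univ k), add_comm]
  have hsum' : ∑ k' : Fin 3, ‖t' (i, k') - t' (j, k')‖ ^ 2 = c + ‖t' (i, k) - t' (j, k)‖ ^ 2 := by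
    rw [← Finset.add_sum_erase _ _ (Finset.mem_univ k), add_comm]
    congr 1
    exact Finset.sum_congr rfl fun k' hk' => by
      rw [hcoord k', if_neg (Finset.ne_of_mem_erase hk'), add_zero]
  have hk : ‖t' (i, k) - t' (j, k)‖ = ‖t (i, k) - t (j, k) + ((s : ℝ) : UnitAddCircle)‖ := by
    rw [hcoord k, if_pos rfl]
  unfold pairDist
  rw [hsum, hsum', hk]
  refine (abs_sqrt_add_sq_sub_sqrt_add_sq_le hc0 (norm_nonneg _) (norm_nonneg _)).trans ?_
  refine (abs_norm_sub_norm_le _ _).trans ?_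
  rw [add_sub_cancel_left]
  exact UnitAddCircle.norm_coe_le_abs s

end Torus

end Literature.Analysis.FunctionSpaces

end
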